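import Mathlib
import Literature.MathematicalPhysics.QuantumManyBody.LiebYngvasonBoxBound
import Literature.MathematicalPhysics.QuantumManyBody.LiebYngvasonCellMethod
import Literature.MathematicalPhysics.QuantumManyBody.BoseGasThermodynamicLimitProofs
import HarnessLib

/-!
# CorePairDominationWithoutCoreHeight — a REFUTED route stub, deprecated (not literature)

Topic `Literature/Uncategorized`. This module holds ONE constant, relocated here by the gate from a
`Summits/AtomisticToContinuum/BoseEinsteinCondensation/Theorems/PuffFloor/Negative/` proposal
(accept-time relocation of tagged propositions written inline in a `Summits/` proposal; human
ruling 2026-08-15).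

* `Literature.Uncategorized.CorePairDominationWithoutCoreHeight` — **FALSE as stated, refuted in
  the tree, DEPRECATED (librarian verdict clean-up 2026-08-16: not a literature fact).** It is the
  registered stub `stub_corePairDomination` of the crux `PuffFloor` (route
  `AtomisticToContinuum/BoseEinsteinCondensation`, line `coupling-slope-pocket`) with the core
  height allowed to vanish (`0 < c₀` weakened to `0 ≤ c₀`), minted by the standing disprover of
  that crux to show that the positive core is load-bearing. Its body is byte-identical to
  `Summit.AtomisticToContinuum.BoseEinsteinCondensation.Theorems.PuffFloor.Negative.CorePairDominationWithoutCore`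
  (module `Summits.AtomisticToContinuum.BoseEinsteinCondensation.Theorems.PuffFloor.Negative.CorePairDominationConstState`),
  whose negation `corePairDomination_false_without_core` is a sorry-free theorem of the tree:
  at `c₀ = 0` the right-hand side is `C` times the kinetic energy, the constant two-particle
  state has none, yet its expected number of `R`-close pairs is `|B̄_R| / L³ > 0`.

## Why it is kept, and kept here

No module imports this one and no declaration names the constant (checked 2026-08-16 over
`Literature/` and `Summits/`): the refutation above states the body under its own name. The
constant is therefore an orphan duplicate; it is not deleted (tree rule: deprecate, never delete)
but it is `@[deprecated]` with a pointer to the refuting theorem, and its docstring says what is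
wrong, so that the named-fact census stops counting it as undischarged literature debt and no
prove seat is placed on it (`CorePairDominationWithoutCoreHeight_holds` cannot exist). Name and
body are unchanged byte for byte. The POSITIVE statement one might want instead is the stub with
`0 < c₀`, a route obligation under `Summits/` (not literature), deliberately not restated here.
-/

namespace Literature.Uncategorized

open Literature.MathematicalPhysics.QuantumManyBody.BoseGas MeasureTheory Complex Finset
open scoped BigOperators ENNReal NNReal

/-- **Deprecated — REFUTED as stated; a FALSE proposition, NOT a literature fact** (no source
asserts it; no `_holds` can exist; never take `(h : CorePairDominationWithoutCoreHeight)` as a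
hypothesis, it proves `False`). `stub_corePairDomination` of line `coupling-slope-pocket` (crux
`PuffFloor`, route `AtomisticToContinuum/BoseEinsteinCondensation`) with the core height `c₀`
allowed to vanish: `0 ≤ c₀` in place of `0 < c₀`, everything else verbatim — for all cut-offs
`r₀, R > 0` there would be `C, L₀` such that for every periodic `N`-particle trial state `Ψ` in a
box of side `L ≥ L₀` the expected number of `R`-close pairs is at most `C` times the energy of `Ψ`
for the soft-core potential `c₀ · 𝟙_{[0,r₀)}`. **What is wrong:** at `c₀ = 0` that energy is the
kinetic energy alone; the constant two-particle state has kinetic energy `0` and a positive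
expected number of close pairs. The negation of the byte-identical Summits-side copy
`…Theorems.PuffFloor.Negative.CorePairDominationWithoutCore` is the theorem
`Summit.AtomisticToContinuum.BoseEinsteinCondensation.Theorems.PuffFloor.Negative.corePairDomination_false_without_core`
(module `…Theorems.PuffFloor.Negative.CorePairDominationConstState`, sorry-free). The lesson it
records for the crux: the positive core `0 < c₀` is load-bearing. Orphan (no importer, no user);
kept deprecated rather than deleted by the tree's no-deletion rule. [folklore] -/
@[deprecated "REFUTED as stated (false at c₀ = 0 for the constant two-particle state): see theorem \
    Summit.AtomisticToContinuum.BoseEinsteinCondensation.Theorems.PuffFloor.Negative.corePairDomination_false_without_core \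
    (module Summits.AtomisticToContinuum.BoseEinsteinCondensation.Theorems.PuffFloor.Negative.CorePairDominationConstState); \
    the intended positive statement is the route stub stub_corePairDomination with 0 < c₀"
  (since := "2026-08-16")]
def CorePairDominationWithoutCoreHeight : Prop :=
  ∀ c₀ r₀ R : ℝ, 0 ≤ c₀ → 0 < r₀ → 0 < R →
    ∃ C L₀ : ℝ, 0 ≤ C ∧ 0 < L₀ ∧ ∀ N : ℕ, ∀ L : ℝ, L₀ ≤ L → ∀ Ψ : PeriodicTrialState N L,
      (∫⁻ X in cellN N L,
          periodicInteraction (Set.indicator (Set.Iic R) (fun _ : ℝ => (1 : ℝ≥0∞))) L X *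
            (‖Ψ.ψ X‖₊ : ℝ≥0∞) ^ 2) ≤
        ENNReal.ofReal C *
          periodicEnergy (Set.indicator (Set.Iio r₀) (fun _ : ℝ => ENNReal.ofReal c₀)) Ψ

end Literature.Uncategorized
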